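import Mathlib
import HarnessLib
import Summits.Ventures.LatticeQCDFlow.Scaling.StochasticBudgets
import Summits.Ventures.LatticeQCDFlow.Exactness.BennettAcceptanceRatio

/-!
# PathWorkMoments — exponential moments of the work on path space: `1/ÊSS = E_F[e^{−2(W−ΔF)}]`,
# the finite Chernoff bound, and the layer-independent second-law tail `P_F(W ≤ ΔF − x) ≤ e^{−x}`

HONEST FRAMING: exact (Metropolis-corrected) sampling algorithms for lattice gauge theory;
figures of merit are autocorrelation/cost numbers at stated couplings and volumes; no
continuum-physics claim.

Venture `LatticeQCDFlow` (cell pub-lqcd), topic `Scaling`; FANOUT row 19 (`su2-snf`, GEN-6).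
OUR WORK, elementary (C. Jarzynski 1997 and H. Chernoff 1952 named only; nothing is cited as a
fact).  The finite path-space setting of `Exactness/JarzynskiFinite` and
`Scaling/StochasticBudgets`: a protocol `S 0, …, S n` of actions on a finite configuration space,
layers `P k` leaving `e^{−S (k+1)}` invariant, the forward path law `P_F` started in equilibrium
at `S 0`, the work `W`, `ΔF = F(S n) − F(S 0)` with `F = −log Z` (`freeEnergy`), and the
reweighting ESS fraction `ÊSS = essFrac P_R P_F` of `StochasticBudgets.essFrac_path_eq`.  This
file isolates the three layer-independent facts about the EXPONENTIAL MOMENTS of the work that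
the row's work-MGF envelope and ESS-floor files (staged `WorkExponentialMoments`,
`GeneralLayerESSFloorSharp`, `GeneralLayerESSFloorAnyGrid`, `WorkGaussianTails`) use, for an
ARBITRARY protocol (no linear family, no grid):

* **`inv_essFrac_path_eq_sum_exp_two`** — `1/ÊSS = E_F[e^{−2(W − ΔF)}]`: the reweighting ESS of
  NE-MCMC is the reciprocal of the SECOND centred exponential moment of the work (Jarzynski at
  `t = 1` normalises `essFrac_path_eq`).  This is the quantity an ESS floor must bound, and the
  population version of the `ess` column (the general-space twin for i.i.d. records is row 13's
  `GeneralNCMC.…_dissipation`; this is the finite path-space form the `Scaling` files compute with);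
  `one_le_sum_exp_two` — hence `E_F[e^{−2(W−ΔF)}] ≥ 1`.
* **`sum_ite_le_exp_mul_sum`** — Markov/Chernoff on a finite space: for non-negative weights and
  `s ≥ 0`, `Σ_{x ≤ f} P ≤ e^{−sx}·Σ P e^{sf}`; specialised to the work: `upperTail_work_le_expMoment`
  (`P_F(W − ΔF ≥ x) ≤ e^{−sx} E_F e^{s(W−ΔF)}`) and `lowerTail_work_le_expMoment`
  (`P_F(W − ΔF ≤ −x) ≤ e^{−tx} E_F e^{−t(W−ΔF)}`), the two entry points of every tail bound
  derived from an MGF envelope.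
* **`lowerTail_work_le_exp_neg`** — THE SECOND-LAW TAIL, layer-independent and exact at every `n`:
  `P_F(W ≤ ΔF − x) ≤ e^{−x}` for every real `x` (`t = 1` above + Jarzynski, with
  `Exactness/BennettAcceptanceRatio`'s `Z_n/Z_0 = e^{−ΔF}`).  Reading for the row's runs
  (`HANDOFF` P9): the fraction of evolutions whose work undershoots the free-energy
  difference by `x` is at most `e^{−x}` whatever the layers, the protocol and `n_step` — a free
  sanity check of the work bookkeeping (an excess can only be a bookkeeping error or a wrong `ΔF`).

NOT CLAIMED: any MGF envelope (those need the `χ²`-contraction hypothesis of the staged files);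
anything about the sample (Kish) statistic of a finite run.
-/

namespace Summit.Ventures.LatticeQCDFlow.Scaling

open Finset
open Literature.Probability.MarkovChains (IsStationary)
open Summit.Ventures.LatticeQCDFlow.Exactness
open Summit.Ventures.LatticeQCDFlow.Theory2

variable {X : Type*} [Fintype X]

/-! ## §1 `1/ÊSS` is the second centred exponential moment of the work -/

/-- `e^{2ΔF} = (Z_0/Z_n)²` for `ΔF = F(S_n) − F(S_0)`, `F = −log Z`. -/
theorem exp_two_mul_freeEnergy_sub [Nonempty X] (S₁ S₀ : X → ℝ) :
    Real.exp (2 * (freeEnergy S₁ - freeEnergy S₀)) = (partitionFn S₀ / partitionFn S₁) ^ 2 := by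
  have hZ1 := partitionFn_pos S₁
  have hZ0 := partitionFn_pos S₀
  unfold freeEnergy
  rw [show 2 * (-Real.log (partitionFn S₁) - -Real.log (partitionFn S₀))
      = ((2 : ℕ) : ℝ) * (Real.log (partitionFn S₀) - Real.log (partitionFn S₁)) by push_cast; ring,
    Real.exp_nat_mul, ← Real.log_div hZ0.ne' hZ1.ne', Real.exp_log (div_pos hZ0 hZ1)]

/-- **`1/ÊSS = E_F[e^{−2(W − ΔF)}]`** for an arbitrary protocol `S` and positive layers leaving
each `e^{−S (k+1)}` invariant (`ΔF = F(S n) − F(S 0)`). -/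
theorem inv_essFrac_path_eq_sum_exp_two [Nonempty X] {n : ℕ} (S : Fin (n + 1) → X → ℝ)
    {P : Fin n → X → X → ℝ} (hPpos : ∀ k x y, 0 < P k x y)
    (hst : ∀ k : Fin n, IsStationary (fun x => Real.exp (-S k.succ x)) (P k)) :
    (essFrac (revPathLaw S P) (pathLaw (gibbsLaw (S 0)) P))⁻¹
      = ∑ ω : Fin (n + 1) → X, pathLaw (gibbsLaw (S 0)) P ω
          * Real.exp (-(2 * (work S ω - (freeEnergy (S (Fin.last n)) - freeEnergy (S 0))))) := by
  rw [essFrac_path_eq S hPpos, jarzynski S P hst]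
  have hZ1 := partitionFn_pos (S (Fin.last n))
  have hZ0 := partitionFn_pos (S 0)
  have hsum : ∑ ω : Fin (n + 1) → X, pathLaw (gibbsLaw (S 0)) P ω
        * Real.exp (-(2 * (work S ω - (freeEnergy (S (Fin.last n)) - freeEnergy (S 0)))))
      = Real.exp (2 * (freeEnergy (S (Fin.last n)) - freeEnergy (S 0)))
        * ∑ ω : Fin (n + 1) → X, pathLaw (gibbsLaw (S 0)) P ω * Real.exp (-(work S ω)) ^ 2 := by
    rw [mul_sum]
    refine sum_congr rfl fun ω _ => ?_
    rw [show -(2 * (work S ω - (freeEnergy (S (Fin.last n)) - freeEnergy (S 0))))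
        = 2 * (freeEnergy (S (Fin.last n)) - freeEnergy (S 0)) + ((2 : ℕ) : ℝ) * (-(work S ω)) by
          push_cast; ring, Real.exp_add, Real.exp_nat_mul]
    ring
  have hden : 0 < ∑ ω : Fin (n + 1) → X, pathLaw (gibbsLaw (S 0)) P ω * Real.exp (-(work S ω)) ^ 2 :=
    sum_pos (fun ω _ => mul_pos (pathLaw_pos (gibbsLaw_pos _) hPpos ω) (pow_pos (Real.exp_pos _) 2))
      univ_nonempty
  rw [hsum, exp_two_mul_freeEnergy_sub, inv_div]
  field_simp

/-- Hence `E_F[e^{−2(W − ΔF)}] ≥ 1` (`ÊSS ≤ 1`), for positive row-stochastic invariant layers. -/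
theorem one_le_sum_exp_two [Nonempty X] {n : ℕ} (S : Fin (n + 1) → X → ℝ)
    {P : Fin n → X → X → ℝ} (hPpos : ∀ k x y, 0 < P k x y) (hProw : ∀ k x, ∑ y, P k x y = 1)
    (hst : ∀ k : Fin n, IsStationary (fun x => Real.exp (-S k.succ x)) (P k)) :
    1 ≤ ∑ ω : Fin (n + 1) → X, pathLaw (gibbsLaw (S 0)) P ω
          * Real.exp (-(2 * (work S ω - (freeEnergy (S (Fin.last n)) - freeEnergy (S 0))))) := by
  have hid := inv_essFrac_path_eq_sum_exp_two S hPpos hst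
  have hspos : 0 < ∑ ω : Fin (n + 1) → X, pathLaw (gibbsLaw (S 0)) P ω
      * Real.exp (-(2 * (work S ω - (freeEnergy (S (Fin.last n)) - freeEnergy (S 0))))) :=
    sum_pos (fun ω _ => mul_pos (pathLaw_pos (gibbsLaw_pos _) hPpos ω) (Real.exp_pos _))
      univ_nonempty
  have hEpos : 0 < essFrac (revPathLaw S P) (pathLaw (gibbsLaw (S 0)) P) := by
    rw [← hid] at hspos
    exact inv_pos.mp hspos
  have hF1 : ∑ ω : Fin (n + 1) → X, pathLaw (gibbsLaw (S 0)) P ω = 1 :=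
    (pathLaw_nonneg_sum_eq_one (fun x => (gibbsLaw_pos (S 0) x).le) (sum_gibbsLaw (S 0))
      fun k => ⟨fun x y => (hPpos k x y).le, hProw k⟩).2
  have hR1 : ∑ ω : Fin (n + 1) → X, revPathLaw S P ω = 1 := sum_revPathLaw S P hst
  have hle := essFrac_le_one (fun ω => pathLaw_pos (gibbsLaw_pos _) hPpos ω) hR1 hF1
  rw [← hid]
  exact one_le_inv_iff₀.mpr ⟨hEpos, hle⟩

/-! ## §2 Markov / Chernoff on a finite space, and the two work-tail entry points -/

omit [Fintype X] in
/-- Markov / Chernoff on a finite space: for non-negative weights `P`, `s ≥ 0` and any `f`, `x`,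
`Σ_{ω : x ≤ f ω} P ω ≤ e^{−s x} · Σ_ω P ω e^{s f ω}`. -/
theorem sum_ite_le_exp_mul_sum {Ω : Type*} [Fintype Ω] {P : Ω → ℝ} (hP : ∀ ω, 0 ≤ P ω)
    (f : Ω → ℝ) (x : ℝ) {s : ℝ} (hs : 0 ≤ s) :
    ∑ ω, (if x ≤ f ω then P ω else 0)
      ≤ Real.exp (-(s * x)) * ∑ ω, P ω * Real.exp (s * f ω) := by
  rw [mul_sum]
  refine sum_le_sum fun ω _ => ?_
  split_ifs with h
  · have he : 1 ≤ Real.exp (-(s * x)) * Real.exp (s * f ω) := by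
      rw [← Real.exp_add]
      exact Real.one_le_exp (by nlinarith)
    calc P ω = P ω * 1 := (mul_one _).symm
      _ ≤ P ω * (Real.exp (-(s * x)) * Real.exp (s * f ω)) := mul_le_mul_of_nonneg_left he (hP ω)
      _ = Real.exp (-(s * x)) * (P ω * Real.exp (s * f ω)) := by ring
  · exact mul_nonneg (Real.exp_pos _).le (mul_nonneg (hP ω) (Real.exp_pos _).le)

/-- UPPER-TAIL ENTRY POINT: `P_F(W − ΔF ≥ x) ≤ e^{−s x} · E_F[e^{s(W − ΔF)}]` for `s ≥ 0` and
non-negative layers (any protocol `S`, any reference value `ΔF`). -/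
theorem upperTail_work_le_expMoment [Nonempty X] {n : ℕ} (S : Fin (n + 1) → X → ℝ)
    {P : Fin n → X → X → ℝ} (hP : ∀ k x y, 0 ≤ P k x y) (ΔF x : ℝ) {s : ℝ} (hs : 0 ≤ s) :
    ∑ ω : Fin (n + 1) → X, (if x ≤ work S ω - ΔF then pathLaw (gibbsLaw (S 0)) P ω else 0)
      ≤ Real.exp (-(s * x))
          * ∑ ω : Fin (n + 1) → X, pathLaw (gibbsLaw (S 0)) P ω * Real.exp (s * (work S ω - ΔF)) :=
  sum_ite_le_exp_mul_sum (fun ω => pathLaw_nonneg (fun x => (gibbsLaw_pos (S 0) x).le) hP ω)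
    (fun ω => work S ω - ΔF) x hs

/-- LOWER-TAIL ENTRY POINT: `P_F(W − ΔF ≤ −x) ≤ e^{−t x} · E_F[e^{−t(W − ΔF)}]` for `t ≥ 0` and
non-negative layers (any protocol `S`, any reference value `ΔF`). -/
theorem lowerTail_work_le_expMoment [Nonempty X] {n : ℕ} (S : Fin (n + 1) → X → ℝ)
    {P : Fin n → X → X → ℝ} (hP : ∀ k x y, 0 ≤ P k x y) (ΔF x : ℝ) {t : ℝ} (ht : 0 ≤ t) :
    ∑ ω : Fin (n + 1) → X, (if x ≤ -(work S ω - ΔF) then pathLaw (gibbsLaw (S 0)) P ω else 0)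
      ≤ Real.exp (-(t * x))
          * ∑ ω : Fin (n + 1) → X,
              pathLaw (gibbsLaw (S 0)) P ω * Real.exp (-(t * (work S ω - ΔF))) := by
  have h := sum_ite_le_exp_mul_sum
    (fun ω => pathLaw_nonneg (fun x => (gibbsLaw_pos (S 0) x).le) hP ω)
    (fun ω => -(work S ω - ΔF)) x ht
  refine h.trans (le_of_eq ?_)
  congr 1
  refine sum_congr rfl fun ω _ => ?_
  rw [show t * -(work S ω - ΔF) = -(t * (work S ω - ΔF)) by ring]

/-! ## §3 The second-law tail: `P_F(W ≤ ΔF − x) ≤ e^{−x}`, layer-independent -/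

/-- **SECOND-LAW TAIL (exact at every `n`, any invariant layers).**  With
`ΔF = F(S n) − F(S 0)`: `P_F(W ≤ ΔF − x) ≤ e^{−x}` for every real `x` — Chernoff at `t = 1`, where
Jarzynski's equality makes `E_F[e^{−(W − ΔF)}] = 1` exactly. -/
theorem lowerTail_work_le_exp_neg [Nonempty X] {n : ℕ} (S : Fin (n + 1) → X → ℝ)
    {P : Fin n → X → X → ℝ} (hP : ∀ k x y, 0 ≤ P k x y)
    (hst : ∀ k : Fin n, IsStationary (fun x => Real.exp (-S k.succ x)) (P k)) (x : ℝ) :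
    ∑ ω : Fin (n + 1) → X,
        (if work S ω ≤ (freeEnergy (S (Fin.last n)) - freeEnergy (S 0)) - x
          then pathLaw (gibbsLaw (S 0)) P ω else 0)
      ≤ Real.exp (-x) := by
  set ΔF := freeEnergy (S (Fin.last n)) - freeEnergy (S 0) with hΔF
  have h := lowerTail_work_le_expMoment S hP ΔF x zero_le_one
  have hJ : ∑ ω : Fin (n + 1) → X, pathLaw (gibbsLaw (S 0)) P ω * Real.exp (-(1 * (work S ω - ΔF)))
      = 1 := by
    have hmul : ∀ ω : Fin (n + 1) → X,
        pathLaw (gibbsLaw (S 0)) P ω * Real.exp (-(1 * (work S ω - ΔF)))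
          = Real.exp ΔF * (pathLaw (gibbsLaw (S 0)) P ω * Real.exp (-work S ω)) := by
      intro ω
      rw [show -(1 * (work S ω - ΔF)) = ΔF + -work S ω by ring, Real.exp_add]; ring
    rw [sum_congr rfl fun ω _ => hmul ω, ← mul_sum, jarzynski S P hst,
      partitionFn_div_eq_exp_neg_freeEnergy_sub (S 0) (S (Fin.last n)),
      ← hΔF, ← Real.exp_add, add_neg_cancel, Real.exp_zero]
  rw [hJ, mul_one, one_mul] at h
  refine le_of_eq_of_le (sum_congr rfl fun ω _ => ?_) h
  have hiff : work S ω ≤ ΔF - x ↔ x ≤ -(work S ω - ΔF) := by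
    constructor <;> intro hω <;> linarith
  simp only [hiff]

end Summit.Ventures.LatticeQCDFlow.Scaling
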